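import Summits.CriticalPhenomena.PercolationContinuityZ3.Theorems.Transplant.SkelFrm1ReachRadQV
import Summits.CriticalPhenomena.PercolationContinuityZ3.Theorems.Transplant.SkelFrm1ReachRadQUV
import Summits.CriticalPhenomena.PercolationContinuityZ3.Theorems.Transplant.SkelPhiReachOblAxes
import Summits.CriticalPhenomena.PercolationContinuityZ3.Theorems.Transplant.SkelFrm1ChoiceLTK
import Summits.CriticalPhenomena.PercolationContinuityZ3.Theorems.Transplant.SkelFrmBParamsCorrKGLen
import Summits.CriticalPhenomena.PercolationContinuityZ3.Theorems.Transplant.SkelPhiCorridorKGBoxes2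
import Summits.CriticalPhenomena.PercolationContinuityZ3.Theorems.Transplant.SkelFrmBChoiceHYV
import HarnessLib

/-!
# N2 (frames-only node `SamePDropOfSkeletonFrm₁`, OPEN), (C) column, THE TARGET OF RECORD (step 1, slot-robust form):
# `PlanarSkeletonFrm.reachHoldsRHNQFnLK_frmChoiceAllQ3V_of_le`

The (C) column Prop of the node theorem under the K-floor, `ReachHoldsRHNQFnLK NegB.LfQ Kmin (frmChoiceAllQ3V gv fv Pv (SUS ex mx) (cR2W mk) (hFR mk) BSlot.small3)`
(SkelFrm1ChoiceLTK; (R-42), node₂ takes `Kmin := 200`), for EVERY box/width/pair/excess/diameter slot value `gv fv Pv ex mx` that dominates the (C) residual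
floors — the two floor families of stmt-g21's value bundles `HX_QV`/`HY_QV` (SkelFrmBChoiceHXV/HYV, stmt-g22): `Hg : gFloorKG … mk ≤ gv ∧ 40·K·KS0.R'0 … mk ≤ gv` (box slot) and
`Hex/HexY : KS0.r₀0 t D mk (RLD …) + 3 ≤ ex ∧ ZD … + 4 ≤ ex` / `… ∧ ZDY … + 4 ≤ ex` (excess slot) — by ONE application of the bundle wrapper
`NegB.reachHoldsRHNQL_choiceAtQ3V_of (HX_QV …) (HY_QV …)` (SkelFrm1ReachHoldsQOfVK; stmt-g22 probe ProbeP5Match 2026-08-23T17:09:21Z + p1-g18 15:28:44Z: the bundles are the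
binders token-for-token) under `reachHoldsRHNQFnLK_frmChoiceAllQ3V_of`; the floor `Kmin ≤ κ.K₀` with `160 ≤ Kmin` serves the rows' `5 ≤ Neg.Kq κ`
(`five_le_Kq_of_le`, from `Neg.kq_ge_of_le`).  The THIN INSTANCE at the node tuple of record (`gv := KS.gT 0 (gxQ 0 gxR)`, `ex := exQ 0 exR`, …; lead g12
11:11:33Z) is `…_of_le 200 (by norm_num) 0 (Hg_Q …) (Hex_Q …) (HexY_Q …)` over stmt-g21/g22 union `SkelFrmBChoiceResidQV` — the separate file SkelFrm1ReachHoldsQ3VNode.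
builds on p205010 (kernel theorem, internal audit signed; external expert review pending) — nothing in this file uses p205010; NOTHING here is a claim about the open
node `SamePDropOfSkeletonFrm₁` (this is one of the four column Props its closure `samePDropOfSkeletonFrm₁_of_choiceFnNQLTK` takes).
Lane `prim-bschramm`, seat `prim-bschramm-p5` (gen 16/17; (C) column); helper file (`--supports stmt-CriticalPhenomena-4575 --as helper`).
[cite: KozmaNitzan2024, §4 Lemma 12 (pp. 23–25), p. 30 (Step IV)] [cite: MartineauTassion2017, §4.3 Lemma 4.2]
G4-B′ MERGED FORM (lead g19 RULING G4-B 2026-08-25T20:00:58Z, gate lint `dedup.landed`): row 68 `SkelFrm1ReachHoldsQOfVK` (p397663, ACCEPTED 10:13Z 08-25 but never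
built — build-queue casualty) is NOT imported; its bundle step (`NegB.reachHoldsRHNQL_choiceAtQ3V_of` under `reachHoldsRHNQFnLK_frmChoiceAllQ3V_of`, a 10-line proof over
`Skel.reachOblRHNOF_of_axes` + `NegB.reachOblAtHNF_frmQ3VR_fst/sndU`) is INLINED in the proof of `reachHoldsRHNQFnLK_frmChoiceAllQ3V_of_le` below, over row 68's six BUILT
parents; NO declaration of row 68 is re-declared here and the two statements of this file are p5's text of record (sha256 6e835ee7…) token for token.
-/

open scoped Classical

noncomputable section

namespace Summit.CriticalPhenomena.PercolationContinuityZ3.Theorems.Transplant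

namespace PlanarSkeletonFrm

open Literature.Probability.Percolation Literature.Probability.LatticeModels SimpleGraph GadgetSystem ProbeHistory HSiteScheme Contour KNCells
open Literature.Probability.Percolation.KozmaNitzan.Cells (oth sgOf)
open KNCells.KSchA KNLevels ChainPlanar ChainPara
open Literature.Barriers.CriticalPhenomena (HasExponentialGrowth graphBall graphBall_mono mem_graphBall_self)
open Skel (ReachOblAtHNF excess)
open SkelI (tanOff)
open SkelConc (Consts)
open BoxProdZ2 (ConcRadiiG)
open TwoAxis.Para (modulus)
open Skelφ (oriφ trφ)
open Skelφ.StepI (DataN DataNS OutNS)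
open BoxProdZ2 (Erad nQ nS)

/-- `160 ≤ Kmin ≤ K₀` gives the rows' `5 ≤ Neg.Kq κ` (`Neg.kq_ge_of_le`, SkelFrm1ChoiceLTK). [this work] -/
theorem five_le_Kq_of_le (κ : Consts) {Kmin : ℕ} (hKmin : 160 ≤ Kmin) (hK : Kmin ≤ κ.K₀) : 5 ≤ Neg.Kq κ :=
  PlanarSkeletonNeg.Neg.kq_ge_of_le κ (m := 4) (by omega)


/-- **THE (C) COLUMN TARGET OF RECORD, SLOT-ROBUST FORM**: for every slot tuple whose box slot dominates `gFloorKG`/`40·K·R'0` and whose excess slot dominates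
the x- and y-depth floors, and every `Kmin ≥ 160`, the choice function of record `frmChoiceAllQ3V gv fv Pv (SUS ex mx) (cR2W mk) (hFR mk) BSlot.small3` meets the
budgeted corridor obligation `ReachHoldsRHNQFnLK NegB.LfQ Kmin`. [cite: KozmaNitzan2024, §4 Lemma 12, p. 30] -/
theorem reachHoldsRHNQFnLK_frmChoiceAllQ3V_of_le (Kmin : ℕ) (hKmin : 160 ≤ Kmin) (mk : ℕ) {gv fv : Neg.FSlot} {Pv : NegB.PSlot} {ex mx : NegB.GSlot}
    (Hg : ∀ (κ : Consts) {V : Type} [DecidableEq V] [Countable V] {G : SimpleGraph V} [G.LocallyFinite] (Φ : PlanarSkeletonFrm G) (t : V) (p : unitInterval)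
      (D : DataNS V), NegB.gFloorKG κ Φ t p D mk ≤ gv κ Φ t p D ∧ 40 * Neg.K κ * NegB.KS0.R'0 κ Φ t p D mk ≤ gv κ Φ t p D)
    (Hex : ∀ (κ : Consts) {V : Type} [DecidableEq V] [Countable V] {G : SimpleGraph V} [G.LocallyFinite] (Φ : PlanarSkeletonFrm G) (t : V) (p : unitInterval)
      (D : DataNS V) (g f : ℕ), NegB.KS0.r₀0 t D mk (NegB.RLD κ Φ t p D g f) + 3 ≤ ex κ Φ t p D g f ∧ NegB.ZD2 κ Φ t p D g f + 4 ≤ ex κ Φ t p D g f)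
    (HexY : ∀ (κ : Consts) {V : Type} [DecidableEq V] [Countable V] {G : SimpleGraph V} [G.LocallyFinite] (Φ : PlanarSkeletonFrm G) (t : V) (p : unitInterval)
      (D : DataNS V) (g f : ℕ), NegB.KS0.r₀0 t D mk (NegB.RLD κ Φ t p D g f) + 3 ≤ ex κ Φ t p D g f ∧ NegB.ZDYW κ Φ t p D g f + 4 ≤ ex κ Φ t p D g f) :
    ReachHoldsRHNQFnLK NegB.LfQ Kmin (frmChoiceAllQ3V gv fv Pv (NegB.SUS ex mx) (NegB.cR2W mk) (NegB.hFR mk) NegB.BSlot.small3) :=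
  fun κ _ _ _ _ _ Φ _ t _ h1 p hp0 hp1 hC hK => by
  -- G4-B′: row 68's bundle step inlined (was `reachHoldsRHNQFnLK_frmChoiceAllQ3V_of Kmin fun … => NegB.reachHoldsRHNQL_choiceAtQ3V_of h1 hp0 hp1 mk (HX_QV …) (HY_QV …)`)
  show (NegB.choiceAtQ3V κ Φ t p Pv gv fv (NegB.SUS ex mx) (NegB.cR2W mk) (NegB.hFR mk) NegB.BSlot.small3 hC).ReachHoldsRHNQL NegB.LfQ
  intro O q hAt
  refine ⟨NegB.LfQ κ.K₀, le_rfl, ?_⟩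
  obtain ⟨ρ, qq, W, HK, N, aW, Bx, bL, hρ1, hρ2, hρ3, hPl, hPt, hLl, ha, hBx, hbL, haq, hbW, hN, hLt⟩ :=
    NegB.HX_QV (hC := hC) (Pv := Pv) (fv := fv) (mx := mx) mk (five_le_Kq_of_le κ hKmin hK) (Hg κ Φ t p) (Hex κ Φ t p) O q hAt
  obtain ⟨ρ', qq', W', HK', N', aW', Bx', bL', hρ1', hρ2', hρ3', hPR', hLl', ha', hBx', hbL', haW', haW'', hbq', hN', hLt'⟩ :=
    NegB.HY_QV (hC := hC) (Pv := Pv) (fv := fv) (mx := mx) mk (five_le_Kq_of_le κ hKmin hK) (Hg κ Φ t p) (HexY κ Φ t p) O q hAt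
  exact Skel.reachOblRHNOF_of_axes
    (fun h e hrun hc hV hdu hne => NegB.reachOblAtHNF_frmQ3VR_fst hAt h1 hp0 hp1 mk hrun hc hV hdu hne HK N hρ1 hρ2 hρ3 hPl hPt hLl
      (hLt (tgt e)) ha hBx hbL haq hbW hN)
    (fun h e hrun hc hV hdu hne => NegB.reachOblAtHNF_frmQ3VR_sndU hAt h1 hp0 hp1 mk hrun hc hV hdu hne HK' N' hρ1' hρ2' hρ3' hPR' hLl'
      (hLt' (tgt e)) ha' hBx' hbL' haW' haW'' hbq' hN')

end PlanarSkeletonFrm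

end Summit.CriticalPhenomena.PercolationContinuityZ3.Theorems.Transplant

end
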